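import Summits.MatrixMultiplication.OmegaCensus.STPP222GLNormalForm
import Literature.Computability.AlgebraicComplexity.STPPTranslation
import Mathlib.Data.ZMod.Units
import Mathlib.Algebra.Ring.AddAut
import Mathlib.Data.Fin.Tuple.Sort
import HarnessLib

/-!
# ω-census: the CYCLIC-ORBIT normal form for `(2,2,2)^k` STPP families in `ℤ/N` is WLOG (kernel side of the seat's SAT breaking `--symc`)

HONEST FRAMING (pub-omega census; verbatim): lottery ticket; floor = certified bounds/negative ranges.
Census STRUCTURE bookkeeping (which cyclic groups host `k` simultaneous-TPP triples of 2-subsets, CKSU 2005 Def. 5.1, tree form `IsSTPP`),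
not progress on `ω`.

WHAT THIS FILE PROVES.  The seat's SAT instrument for the `k = 6` ladder cells (kit bundle `kit-satcyc`, encoder `stppcnf_v6.py`) searches
ONLY families in the following normal form (option `--symc`, single modulus `N`):
(N1) `0 ∈ A i` for every `i`; (N2) `0 ∈ B 0` and `0 ∈ C 0`; (N3) `A 0 = {0, d}` with `d` a divisor of `N`, `0 < d < N` (cast to `ℤ/N`);
(N4) writing `A i = {0, q i}` for `i ≠ 0`, the numbers `rep (q i) = min (val (q i)) (val (−q i))` are non-decreasing in `i` on `1 … k`.
((N1)–(N4) are spelled out literally in the statements; no definitions in this file.)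
`exists_cyclicNormalForm`: **every STPP family of `k+1` triples of 2-subsets of `ℤ/N` can be replaced by one in this normal form** — by the
STPP symmetries already in the Literature tree: per-member translations (`IsSTPP.translate`), the global `B`/`C` shifts (`IsSTPP.shiftBC`),
an additive automorphism (`IsSTPP.map_addEquiv`; here `x ↦ x·u⁻¹` for a unit `u` with `a = u·d`, Mathlib's `ZMod.eq_unit_mul_divisor`), and
re-indexing (`IsSTPP.comp_of_injective` with a sorting permutation of the members `1 … k`).  Corollary `no_family_of_no_cyclicNormalForm`: if no
normal-form family exists then `ℤ/N` hosts no `(2,2,2)^{k+1}` family at all — so an UNSAT answer of the instrument, which imposes exactly (N1)–(N4)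
as clauses, is a COMPLETE verdict modulo the (separately validated) literal encoding of Def. 5.1.  No cell is decided in this file.
Companion (same idea for `(ℤ/p)³` and the `gl` normal form): `STPP222GLNormalForm.lean` (ENG1).

References: H. Cohn, R. Kleinberg, B. Szegedy, C. Umans, FOCS 2005 (arXiv:math/0511460), Def. 5.1.  Record: pub-omega HOME `STATUS.md`
2026-08-27 (stpp-3 gen 20, card 'stpp3-satcyc'; HOME `pub-omega-stpp-3-g20/code/kit-satcyc/README.md`).
-/

open Finset Literature.Computability.AlgebraicComplexity

namespace Summit.MatrixMultiplication.OmegaCensus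

namespace CycNF

section Generic

variable {H : Type*} [AddCommGroup H] [DecidableEq H] {k : ℕ}

omit [AddCommGroup H] in
/-- A two-element set containing `x` is `{x, y}` for some `y ≠ x`. -/
theorem eq_pair_of_card_two {s : Finset H} (hs : s.card = 2) {x : H} (hx : x ∈ s) :
    ∃ y, y ≠ x ∧ s = {x, y} := by
  obtain ⟨a, b, hab, rfl⟩ := Finset.card_eq_two.1 hs
  simp only [Finset.mem_insert, Finset.mem_singleton] at hx
  rcases hx with rfl | rfl
  · exact ⟨b, hab.symm, rfl⟩
  · exact ⟨a, hab, Finset.pair_comm _ _⟩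

/-- Translating a finite set does not change its cardinality. -/
theorem card_image_add_right (s : Finset H) (t : H) : (s.image (· + t)).card = s.card :=
  Finset.card_image_of_injective s (add_left_injective t)

/-- **Stage 1 (N1, N2), any abelian group:** translate member `i` by minus an element of `A i`, then shift all `B`-sets and all
`C`-sets so that `B 0` and `C 0` contain `0`. [cite: CohnKleinbergSzegedyUmans2005, Def. 5.1] -/
theorem stage1 {A B C : Fin (k + 1) → Finset H} (hS : IsSTPP A B C) (hc : ∀ i, (A i).card = 2 ∧ (B i).card = 2 ∧ (C i).card = 2) :
    ∃ A₁ B₁ C₁ : Fin (k + 1) → Finset H, IsSTPP A₁ B₁ C₁ ∧ (∀ i, (A₁ i).card = 2 ∧ (B₁ i).card = 2 ∧ (C₁ i).card = 2) ∧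
      (∀ i, (0 : H) ∈ A₁ i) ∧ (0 : H) ∈ B₁ 0 ∧ (0 : H) ∈ C₁ 0 := by
  have hne : ∀ i, (A i).Nonempty := fun i => Finset.card_pos.1 (by rw [(hc i).1]; norm_num)
  choose a ha using hne
  have hBne : ((B 0).image (· + -a 0)).Nonempty :=
    (Finset.image_nonempty).2 (Finset.card_pos.1 (by rw [(hc 0).2.1]; norm_num))
  have hCne : ((C 0).image (· + -a 0)).Nonempty :=
    (Finset.image_nonempty).2 (Finset.card_pos.1 (by rw [(hc 0).2.2]; norm_num))
  obtain ⟨b, hb⟩ := hBne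
  obtain ⟨c, hcc⟩ := hCne
  refine ⟨fun i => (A i).image (· + -a i), fun i => ((B i).image (· + -a i)).image (· + -b),
    fun i => ((C i).image (· + -a i)).image (· + -c), hS.translate_shiftBC (fun i => -a i) (-b) (-c), ?_, ?_, ?_, ?_⟩
  · intro i
    refine ⟨?_, ?_, ?_⟩
    · rw [card_image_add_right]; exact (hc i).1
    · rw [card_image_add_right, card_image_add_right]; exact (hc i).2.1
    · rw [card_image_add_right, card_image_add_right]; exact (hc i).2.2
  · intro i
    exact Finset.mem_image.2 ⟨a i, ha i, by simp⟩
  · exact Finset.mem_image.2 ⟨b, hb, by simp⟩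
  · exact Finset.mem_image.2 ⟨c, hcc, by simp⟩

omit [DecidableEq H] in
/-- **Stage 3 (N4), any abelian group with a numerical key `key : H → ℕ`:** re-index the members `1 … k` so that `key (q i)` is
non-decreasing, where `A i = {0, q i}`; member `0` and all sets are untouched (the lifted sorting permutation is ENG1's `GLNF.liftPerm`). [cite: CohnKleinbergSzegedyUmans2005, Def. 5.1] -/
theorem stage3 (key : H → ℕ) {A B C : Fin (k + 1) → Finset H} (hS : IsSTPP A B C) (hc : ∀ i, (A i).card = 2 ∧ (B i).card = 2 ∧ (C i).card = 2)
    (q : Fin (k + 1) → H) :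
    ∃ ι : Fin (k + 1) → Fin (k + 1), Function.Injective ι ∧ ι 0 = 0 ∧ (∀ i, i ≠ 0 → ι i ≠ 0) ∧
      IsSTPP (fun i => A (ι i)) (fun i => B (ι i)) (fun i => C (ι i)) ∧
      (∀ i, (A (ι i)).card = 2 ∧ (B (ι i)).card = 2 ∧ (C (ι i)).card = 2) ∧
      ∀ i j : Fin (k + 1), i ≠ 0 → i ≤ j → key (q (ι i)) ≤ key (q (ι j)) := by
  let f : Fin k → ℕ := fun m => key (q m.succ)
  let σ : Equiv.Perm (Fin k) := Tuple.sort f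
  have hmono : Monotone (f ∘ σ) := Tuple.monotone_sort f
  refine ⟨GLNF.liftPerm σ, GLNF.liftPerm_injective σ, rfl, fun i hi => GLNF.liftPerm_ne_zero σ hi,
    hS.comp_of_injective _ (GLNF.liftPerm_injective σ), fun i => hc _, ?_⟩
  intro i j hi hij
  cases i using Fin.cases with
  | zero => exact absurd rfl hi
  | succ m =>
    cases j using Fin.cases with
    | zero => exact absurd hij (not_le.mpr (Fin.succ_pos m))
    | succ m' =>
      rw [GLNF.liftPerm_succ, GLNF.liftPerm_succ]
      exact hmono (Fin.succ_le_succ_iff.mp hij)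

end Generic

section Cyclic

variable {N : ℕ} [NeZero N] {k : ℕ}

/-- **Stage 2 (N3), `ℤ/N`:** if `A 0 = {0, a}` then some additive automorphism `x ↦ x·v` (`v` a unit) maps `a` to a divisor `d` of `N` with
`0 < d < N` (Mathlib's `ZMod.eq_unit_mul_divisor`: `a = u·d`, take `v = u⁻¹`); automorphisms preserve the STPP, the cardinalities and the zeros.
[cite: CohnKleinbergSzegedyUmans2005, Def. 5.1] -/
theorem stage2 {A B C : Fin (k + 1) → Finset (ZMod N)} (hS : IsSTPP A B C) (hc : ∀ i, (A i).card = 2 ∧ (B i).card = 2 ∧ (C i).card = 2)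
    (hA : ∀ i, (0 : ZMod N) ∈ A i) (hB : (0 : ZMod N) ∈ B 0) (hC : (0 : ZMod N) ∈ C 0) :
    ∃ A₂ B₂ C₂ : Fin (k + 1) → Finset (ZMod N), IsSTPP A₂ B₂ C₂ ∧ (∀ i, (A₂ i).card = 2 ∧ (B₂ i).card = 2 ∧ (C₂ i).card = 2) ∧
      (∀ i, (0 : ZMod N) ∈ A₂ i) ∧ (0 : ZMod N) ∈ B₂ 0 ∧ (0 : ZMod N) ∈ C₂ 0 ∧
      ∃ d : ℕ, d ∣ N ∧ 0 < d ∧ d < N ∧ A₂ 0 = {0, (d : ZMod N)} := by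
  obtain ⟨a, ha0, hAa⟩ := eq_pair_of_card_two (hc 0).1 (hA 0)
  obtain ⟨d, hdN, u, hu, hau⟩ := ZMod.eq_unit_mul_divisor a
  -- the automorphism x ↦ x * u⁻¹
  let φ : ZMod N ≃+ ZMod N := AddAut.mulRight hu.unit⁻¹
  have hφ : ∀ x : ZMod N, φ x = x * ↑(hu.unit⁻¹) := fun x => rfl
  have hφa : φ a = (d : ZMod N) := by
    rw [hφ, hau, mul_comm u, mul_assoc, IsUnit.mul_val_inv, mul_one]
  have hφ0 : φ 0 = 0 := map_zero φ
  have hd0 : (d : ZMod N) ≠ 0 := by rw [← hφa]; intro h; exact ha0 (φ.injective (h.trans hφ0.symm))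
  have hdpos : 0 < d := Nat.pos_of_ne_zero fun h => hd0 (by rw [h, Nat.cast_zero])
  have hdlt : d < N := by
    rcases (Nat.le_of_dvd (Nat.pos_of_ne_zero (NeZero.ne N)) hdN).lt_or_eq with h | h
    · exact h
    · exact absurd (by rw [h, ZMod.natCast_self]) hd0
  refine ⟨fun i => (A i).image φ, fun i => (B i).image φ, fun i => (C i).image φ, hS.map_addEquiv φ, ?_, ?_, ?_, ?_,
    d, hdN, hdpos, hdlt, ?_⟩
  · intro i
    exact ⟨by rw [Finset.card_image_of_injective _ φ.injective]; exact (hc i).1,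
      by rw [Finset.card_image_of_injective _ φ.injective]; exact (hc i).2.1,
      by rw [Finset.card_image_of_injective _ φ.injective]; exact (hc i).2.2⟩
  · intro i; exact Finset.mem_image.2 ⟨0, hA i, hφ0⟩
  · exact Finset.mem_image.2 ⟨0, hB, hφ0⟩
  · exact Finset.mem_image.2 ⟨0, hC, hφ0⟩
  · show (A 0).image φ = {0, (d : ZMod N)}
    rw [hAa, Finset.image_insert, Finset.image_singleton, hφ0, hφa]

/-- **THE WLOG THEOREM (cyclic orbit normal form).**  Every STPP family of `k+1` triples of 2-subsets of `ℤ/N` can be replaced by one in the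
normal form (N1)–(N4) of the seat's SAT breaking `--symc` — so a complete search (or an UNSAT certificate) restricted to normal-form families decides
the existence of ANY such family in `ℤ/N`. [cite: CohnKleinbergSzegedyUmans2005, Def. 5.1] -/
theorem exists_cyclicNormalForm {A B C : Fin (k + 1) → Finset (ZMod N)} (hS : IsSTPP A B C) (hc : ∀ i, (A i).card = 2 ∧ (B i).card = 2 ∧ (C i).card = 2) :
    ∃ A' B' C' : Fin (k + 1) → Finset (ZMod N), IsSTPP A' B' C' ∧ (∀ i, (A' i).card = 2 ∧ (B' i).card = 2 ∧ (C' i).card = 2) ∧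
      (∀ i, (0 : ZMod N) ∈ A' i) ∧ (0 : ZMod N) ∈ B' 0 ∧ (0 : ZMod N) ∈ C' 0 ∧
      (∃ d : ℕ, d ∣ N ∧ 0 < d ∧ d < N ∧ A' 0 = {0, (d : ZMod N)}) ∧
      ∃ q : Fin (k + 1) → ZMod N, (∀ i, i ≠ 0 → A' i = {0, q i}) ∧
        ∀ i j : Fin (k + 1), i ≠ 0 → i ≤ j → min (q i).val (-(q i)).val ≤ min (q j).val (-(q j)).val := by
  obtain ⟨A₁, B₁, C₁, hS₁, hc₁, hA₁, hB₁, hC₁⟩ := stage1 hS hc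
  obtain ⟨A₂, B₂, C₂, hS₂, hc₂, hA₂, hB₂, hC₂, d, hdN, hd0, hdlt, hA₂0⟩ := stage2 hS₁ hc₁ hA₁ hB₁ hC₁
  -- the nonzero element of each A₂ i
  have hq : ∀ i, ∃ q : ZMod N, q ≠ 0 ∧ A₂ i = {0, q} := fun i => eq_pair_of_card_two (hc₂ i).1 (hA₂ i)
  choose q hq0 hAq using hq
  obtain ⟨ι, hι, hι0, hιne, hS₃, hc₃, hsort⟩ := stage3 (fun x : ZMod N => min x.val (-x).val) hS₂ hc₂ q
  refine ⟨_, _, _, hS₃, hc₃, fun i => hA₂ _, ?_, ?_, ⟨d, hdN, hd0, hdlt, ?_⟩, fun i => q (ι i), fun i _ => hAq _, hsort⟩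
  · show (0 : ZMod N) ∈ B₂ (ι 0); rw [hι0]; exact hB₂
  · show (0 : ZMod N) ∈ C₂ (ι 0); rw [hι0]; exact hC₂
  · show A₂ (ι 0) = {0, (d : ZMod N)}; rw [hι0]; exact hA₂0

/-- **Corollary (the form the census uses):** if NO normal-form family of `k+1` triples of 2-sets exists in `ℤ/N`, then `ℤ/N` hosts no
`(2,2,2)^{k+1}` STPP family at all. [cite: CohnKleinbergSzegedyUmans2005, Def. 5.1] -/
theorem no_family_of_no_cyclicNormalForm
    (h : ∀ A B C : Fin (k + 1) → Finset (ZMod N), (∀ i, (A i).card = 2 ∧ (B i).card = 2 ∧ (C i).card = 2) →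
      ((∀ i, (0 : ZMod N) ∈ A i) ∧ (0 : ZMod N) ∈ B 0 ∧ (0 : ZMod N) ∈ C 0 ∧
        (∃ d : ℕ, d ∣ N ∧ 0 < d ∧ d < N ∧ A 0 = {0, (d : ZMod N)}) ∧
        ∃ q : Fin (k + 1) → ZMod N, (∀ i, i ≠ 0 → A i = {0, q i}) ∧
          ∀ i j : Fin (k + 1), i ≠ 0 → i ≤ j → min (q i).val (-(q i)).val ≤ min (q j).val (-(q j)).val) → ¬ IsSTPP A B C) :
    ¬ ∃ A B C : Fin (k + 1) → Finset (ZMod N), IsSTPP A B C ∧ ∀ i, (A i).card = 2 ∧ (B i).card = 2 ∧ (C i).card = 2 := by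
  rintro ⟨A, B, C, hS, hc⟩
  obtain ⟨A', B', C', hS', hc', hnf⟩ := exists_cyclicNormalForm hS hc
  exact h A' B' C' hc' hnf hS'

end Cyclic

end CycNF

end Summit.MatrixMultiplication.OmegaCensus
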